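import Summits.BirchSwinnertonDyer.Rank1Residual.WAll.Target
import Summits.BirchSwinnertonDyer.Rank1Residual.Partition.CornersAll
import HarnessLib

/-!
# Rung W-ALL of ladder BSD (D-0120) — the KERNEL: W-ALL from the closed list of exclusion classes
# and the fourteen print binders of `CornersAll`; the glue of the sub-classes; the Miller bridge
# to the leading-term formula (cell `bsd-wall`, lane (2), seat `bsd-wall-ty-1`)

HONEST FRAMING (cell `bsd-wall`, run/shared/lean/pub/bsd-wall/; brief `WALL-BRIEF-v1.md` sha16
b966bf16da27706e): bookkeeping over the statements of `Rank1Residual/WAll/Target.lean` — nothing is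
asserted, nothing is booked, no named fact is introduced; every published theorem enters as one of
the fourteen named print binders of
`Summit.BirchSwinnertonDyer.Rank1Residual.bsdp_allCurves_of_not_corner_of_not_cornerF`
(`Partition/CornersAll.lean`) or one of the two sign binders of the tree's Miller bridge.

* §3 glue: `WAllExclAdditive ↔ WAllExclX3 ∧ WAllExclX4`, `WAllExclMultRankOne ↔ WAllExclX11b ∧
  WAllExclX2RankOne`, `WAllCornerF ↔ WAllCornerFTwo ∧ WAllCornerFRamified ∧ WAllCornerFInertBad`,
  and `WAllCornerF` from its sharp form + Li–Tian–Yan–Zhu 2025 Thm 1.1 (ii).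
* §4 `wAll_of_conjunction` (the kernel form of the rung): the twelve exclusion `Prop`s (row 1 =
  the reused leaf `NonCMAtTwo`) + the fourteen print binders ⇒ `WAll`; proof = CornersAll + case
  split, no mathematics beyond the reduction-type trichotomy.
* §5 the converse `WAll → WAllExclusions` (unconditional) and `wAll_iff_exclusions`.
* §6 `WAll ↔ WAllFormula` modulo modularity, `L(E,1) ≥ 0`, Gross–Zagier (the sign of `#Ш_an`;
  `bsdTriple_of_forall_bsdp'`, `shaAn_re_pos_of_analyticRank_le_one'`, `forall_bsdp_of_bsdTriple'`),
  and `BSDConjecture → WAllFormula`.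

References: `Rank1Residual/WAll/Target.lean` (module docstring: the closed list, row table, the
Manin ruling); `Partition/CornersAll.lean`, `Partition/CornersCM.lean`; [cite: Miller2011LMS, §1 and
Def. 1.1]; [cite: Tate1974].
-/

noncomputable section

open scoped Classical

open WeierstrassCurve Literature.NumberTheory.EllipticCurves
  Literature.NumberTheory.EllipticCurves.Rank1Residual Literature.NumberTheory.EllipticCurves.ModularForms
open Summit.BirchSwinnertonDyer.Rank1Residual
open Summit.BirchSwinnertonDyer.BirchSwinnertonDyer.Rank1Residual (NonCMAtTwo)

set_option autoImplicit false

namespace Summit.BirchSwinnertonDyer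

/-! ### §3. Glue of the sub-classes (rows 2, 3, 12) -/

/-- Row 2 = X3 ∧ X4: an odd additive prime has `E[p]` reducible or irreducible. [folklore] -/
theorem wAllExclAdditive_iff : WAllExclAdditive ↔ WAllExclX3 ∧ WAllExclX4 := by
  constructor
  · intro h
    exact ⟨fun W _ _ p _ hcm hp hX hr ↦ h W p hcm hp hX.2 hr,
      fun W _ _ p _ hcm hX hr ↦ h W p hcm hX.1 hX.2.1 hr⟩
  · rintro ⟨h3, h4⟩ W _ _ p _ hcm hp hadd hr
    by_cases hirr : Irr W p
    · exact h4 W p hcm ⟨hp, hadd, hirr⟩ hr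
    · exact h3 W p hcm hp ⟨hirr, hadd⟩ hr

/-- Row 3 = X11b ∧ X2c: an odd multiplicative prime in rank one has `E[p]` irreducible (X11b) or
reducible (X2c). [folklore] -/
theorem wAllExclMultRankOne_iff : WAllExclMultRankOne ↔ WAllExclX11b ∧ WAllExclX2RankOne := by
  constructor
  · intro h
    exact ⟨fun W _ _ p _ hcm hX ↦ h W p hcm hX.2.1 hX.2.2.1 hX.1,
      fun W _ _ p _ hcm hX hr1 ↦ h W p hcm hX.1 hX.2.2 hr1⟩
  · rintro ⟨h11b, h2c⟩ W _ _ p _ hcm hp hm hr1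
    by_cases hirr : Irr W p
    · exact h11b W p hcm ⟨hr1, hp, hm, hirr⟩
    · exact h2c W p hcm ⟨hp, hirr, hm⟩ hr1

/-- Row 12 = K12₂ ∧ K12r ∧ K12i (`cornerF_iff_inert_bad_or_ramified_or_two`). [folklore] -/
theorem wAllCornerF_iff :
    WAllCornerF ↔ WAllCornerFTwo ∧ WAllCornerFRamified ∧ WAllCornerFInertBad := by
  constructor
  · intro h
    refine ⟨fun W _ _ hcm hr1 ↦ h W 2 ⟨hcm, hr1, Or.inl rfl⟩, fun W _ _ p _ hcm hr1 hp hram ↦ ?_,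
      fun W _ _ p _ hcm hr1 hp hin hng ↦ ?_⟩
    · exact h W p ((cornerF_iff_inert_bad_or_ramified_or_two hcm hr1).2 (Or.inr (Or.inl ⟨hp, hram⟩)))
    · exact h W p
        ((cornerF_iff_inert_bad_or_ramified_or_two hcm hr1).2 (Or.inr (Or.inr ⟨hp, hin, hng⟩)))
  · rintro ⟨h2, hram, hin⟩ W _ _ p _ hF
    have hcm : W.HasCM := hF.1
    have hr1 : W.analyticRank = 1 := hF.2.1
    rcases (cornerF_iff_inert_bad_or_ramified_or_two hcm hr1).1 hF with hp2 | ⟨hp, hr⟩ | ⟨hp, hi, hng⟩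
    · subst hp2
      exact h2 W hcm hr1
    · exact hram W p hcm hr1 hp hr
    · exact hin W p hcm hr1 hp hi hng

/-- `WAllCornerF` implies its sharp form (`CornerF♯ ⊆ CornerF`). [folklore] -/
theorem wAllCornerFSharp_of_cornerF (h : WAllCornerF) : WAllCornerFSharp :=
  fun W _ _ p _ hX ↦ h W p (cornerF_of_cornerFSharp hX)

/-- **Row 12 from its sharp form and Li–Tian–Yan–Zhu, PAMQ 21 (2025) Thm 1.1 (ii)** (named fact
`hLTYZ`): the sub-cell "CM, rank one, `p = 2`, good ordinary at `2`" of `CornerF` is closed in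
refereed print (`LiTianYanZhu2025.bsdp_two_of_goodOrd`), the rest is `CornerF♯`. [folklore] -/
theorem wAllCornerF_of_sharp (hLTYZ : LiTianYanZhu2025.thm11_bsdp_of_cm_rank_one)
    (h : WAllCornerFSharp) : WAllCornerF := by
  intro W _ _ p _ hF
  rcases cornerF_iff_cornerFSharp_or_goodOrd_two.1 hF with hS | ⟨hcm, hr1, hp2, hgo⟩
  · exact h W p hS
  · subst hp2
    exact LiTianYanZhu2025.bsdp_two_of_goodOrd hLTYZ W hcm hgo.1 hgo.2 hr1

/-! ### §4. The kernel theorem: W-ALL from the closed list and the fourteen print binders -/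

/-- **W-ALL FROM THE CONJUNCTION (kernel form of rung W-ALL).** Granted the twelve exclusion-class
`Prop`s of the closed list (rows 1–12) and the fourteen named published facts of
`bsdp_allCurves_of_not_corner_of_not_cornerF` (Skinner 2016 Thm C, BCS25 Cor 1.3.1, JSW17 Thm 1.2.1,
CGS25 Thm D, Greenberg–Vatsal 2000 Thm 1.3 + Greenberg 1999, modularity ×2, Gross–Zagier–Kolyvagin,
Rubin 1991/Burungale–Flach 2024, Kobayashi 2013 Cor 1.4, Yan–Zhu 2026 Thm 4.15, Wuthrich 2014
Lemma 20, Li–Liu–Tian 2024 Thm 1.1): `BSD(E,p)` for EVERY `E/ℚ` of analytic rank `≤ 1` and EVERY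
prime `p`. Proof = CornersAll + case split: CM? (`CornerF` is row 12, else `bsdp_cm_of_not_cornerF`);
non-CM: `p = 2` (row 1) · additive (row 2) · multiplicative with `r = 1` (row 3) · otherwise the pair
is in CornersAll's domain `p ≠ 2 ∧ (Good ∨ (Mult ∧ r = 0))` and either lies in one of the eight
corners (rows 4–11; at a corner-X2 pair `p` is multiplicative, hence `r = 0` here) or is covered.
No mathematics beyond the reduction-type trichotomy. [folklore] -/
theorem wAll_of_conjunction (h5 : NonCMAtTwo) (hAdd : WAllExclAdditive)
    (hM1 : WAllExclMultRankOne) (hX1 : WAllCornerX1) (hX2 : WAllCornerX2) (hX6 : WAllCornerX6r0)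
    (hX7 : WAllCornerX7) (hX8 : WAllCornerX8) (hX9 : WAllCornerX9) (hX10b : WAllCornerX10b)
    (hX11a : WAllCornerX11a) (hF : WAllCornerF)
    (hSk : Skinner2016.thmC_padicValRat_bsd_rank_zero)
    (hBCS : BurungaleCastellaSkinner2025.cor131_padicValRat_bsd_rank_le_one)
    (hJSW : JetchevSkinnerWan2017.thm121_padicValRat_bsd_rank_one)
    (hCGS : CastellaGrossiSkinner2025.thmD_padicValRat_bsd_rank_le_one)
    (hGV : GreenbergVatsal2000.thm13_charIdeal_eq_of_gvPar) (hGr : greenberg_charValue_rankZero)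
    (hmod : hasEntireLFunction_rat) (hmodP : nonempty_modularParametrizationData)
    (hGZK : rank_eq_analyticRank_of_analyticRank_le_one)
    (hCM : bsdTriple_of_hasCM_of_L_one_ne_zero) (hKob : Kobayashi2013.cor14_bsdp_of_cm_rank_one)
    (hYZ : YanZhu2026.thm415_padicValRat_bsd_rank_le_one)
    (hW20 : Wuthrich2014.lemma20_surjective_threeAdic_of_semistable)
    (hLLT : LiLiuTian2024.thm11_bsdp_of_cm_rank_one) : WAll := by
  intro W _ _ p _ hr
  by_cases hcm : W.HasCM
  · -- CM axis: the corner is row 12, its complement is covered (rows C8 / C17 / C10)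
    by_cases hcF : CornerF W p
    · exact hF W p hcF
    · exact bsdp_cm_of_not_cornerF hCM hmod hLLT hKob hcm hr hcF
  · by_cases hp : p = 2
    · -- row 1: non-CM at `p = 2`
      subst hp
      exact h5 W hcm hr
    · by_cases hadd : Addv W p
      · -- row 2: additive
        exact hAdd W p hcm hp hadd hr
      · by_cases hm1 : Mult W p ∧ W.analyticRank = 1
        · -- row 3: multiplicative, rank one
          exact hM1 W p hcm hp hm1.1 hm1.2
        · -- the domain of CornersAll: `p` odd, good or (multiplicative and `r = 0`)
          have hdom : Good W p ∨ (Mult W p ∧ W.analyticRank = 0) := by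
            by_cases hg : Good W p
            · exact Or.inl hg
            · have hm : Mult W p := by
                by_contra hm
                exact hadd ⟨hg, hm⟩
              have h1 : W.analyticRank ≠ 1 := fun h1 ↦ hm1 ⟨hm, h1⟩
              exact Or.inr ⟨hm, by omega⟩
          -- the eight non-CM corners, rows 4–11
          by_cases c1 : ClassX1 W p
          · exact hX1 W p hcm c1 hr
          by_cases c9 : ClassX9 W p
          · exact hX9 W p c9 hr
          by_cases c10 : ClassX10 W p ∧ ¬ Surj W p
          · exact hX10b W p hcm c10.1 c10.2 hr
          by_cases c6 : ClassX6 W p ∧ W.analyticRank = 0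
          · exact hX6 W p hcm hp c6.1 c6.2
          by_cases c7 : ClassX7 W p
          · exact hX7 W p hcm hp c7 hr
          by_cases c8 : ClassX8 W p
          · exact hX8 W p hcm c8 hr
          by_cases c11a : ClassX11a W p
          · exact hX11a W p hcm c11a
          by_cases c2 : ClassX2 W p
          · -- a corner-X2 pair is multiplicative, hence of rank `0` in this domain
            have hr0 : W.analyticRank = 0 := by
              rcases hdom with hg | ⟨-, hr0⟩
              · exact absurd c2.2.2 (not_mult_of_good W p hg)
              · exact hr0
            exact hX2 W p hcm c2 hr0
          -- no corner: covered
          exact bsdp_allCurves_of_not_corner_of_not_cornerF hSk hBCS hJSW hCGS hGV hGr hmod hmodP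
            hGZK hCM hKob hYZ hW20 hLLT hr (Or.inr ⟨hp, hdom⟩)
            (fun _ ↦ ⟨c1, c9, c10, c6, c7, c8, c11a, c2⟩) (fun h ↦ absurd h hcm)

/-- **W-ALL from the packaged conjunction** `WAllExclusions` and the fourteen print binders. [folklore] -/
theorem wAll_of_exclusions (h : WAllExclusions)
    (hSk : Skinner2016.thmC_padicValRat_bsd_rank_zero)
    (hBCS : BurungaleCastellaSkinner2025.cor131_padicValRat_bsd_rank_le_one)
    (hJSW : JetchevSkinnerWan2017.thm121_padicValRat_bsd_rank_one)
    (hCGS : CastellaGrossiSkinner2025.thmD_padicValRat_bsd_rank_le_one)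
    (hGV : GreenbergVatsal2000.thm13_charIdeal_eq_of_gvPar) (hGr : greenberg_charValue_rankZero)
    (hmod : hasEntireLFunction_rat) (hmodP : nonempty_modularParametrizationData)
    (hGZK : rank_eq_analyticRank_of_analyticRank_le_one)
    (hCM : bsdTriple_of_hasCM_of_L_one_ne_zero) (hKob : Kobayashi2013.cor14_bsdp_of_cm_rank_one)
    (hYZ : YanZhu2026.thm415_padicValRat_bsd_rank_le_one)
    (hW20 : Wuthrich2014.lemma20_surjective_threeAdic_of_semistable)
    (hLLT : LiLiuTian2024.thm11_bsdp_of_cm_rank_one) : WAll := by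
  obtain ⟨h5, hAdd, hM1, hX1, hX2, hX6, hX7, hX8, hX9, hX10b, hX11a, hF⟩ := h
  exact wAll_of_conjunction h5 hAdd hM1 hX1 hX2 hX6 hX7 hX8 hX9 hX10b hX11a hF hSk hBCS hJSW hCGS hGV
    hGr hmod hmodP hGZK hCM hKob hYZ hW20 hLLT

/-! ### §5. Conversely: every exclusion class is a consequence of W-ALL (unconditionally), so the
closed list is EXACTLY the rung modulo the print binders -/

/-- Each of the twelve exclusion `Prop`s follows from `WAll` (they are special cases). [folklore] -/
theorem wAllExclusions_of_wAll (h : WAll) : WAllExclusions := by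
  refine ⟨fun W _ _ _ hr ↦ h W 2 hr, fun W _ _ p _ _ _ _ hr ↦ h W p hr,
    fun W _ _ p _ _ _ _ hr1 ↦ h W p (by omega), fun W _ _ p _ _ _ hr ↦ h W p hr,
    fun W _ _ p _ _ _ hr0 ↦ h W p (by omega), fun W _ _ p _ _ _ _ hr0 ↦ h W p (by omega),
    fun W _ _ p _ _ _ _ hr ↦ h W p hr, fun W _ _ p _ _ _ hr ↦ h W p hr, fun W _ _ p _ _ hr ↦ h W p hr,
    fun W _ _ p _ _ _ _ hr ↦ h W p hr, fun W _ _ p _ _ hX ↦ h W p (by have := hX.1; omega),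
    fun W _ _ p _ hX ↦ h W p (by have := hX.2.1; omega)⟩

/-- **The closed list is exactly W-ALL modulo the fourteen print binders.** [folklore] -/
theorem wAll_iff_exclusions (hSk : Skinner2016.thmC_padicValRat_bsd_rank_zero)
    (hBCS : BurungaleCastellaSkinner2025.cor131_padicValRat_bsd_rank_le_one)
    (hJSW : JetchevSkinnerWan2017.thm121_padicValRat_bsd_rank_one)
    (hCGS : CastellaGrossiSkinner2025.thmD_padicValRat_bsd_rank_le_one)
    (hGV : GreenbergVatsal2000.thm13_charIdeal_eq_of_gvPar) (hGr : greenberg_charValue_rankZero)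
    (hmod : hasEntireLFunction_rat) (hmodP : nonempty_modularParametrizationData)
    (hGZK : rank_eq_analyticRank_of_analyticRank_le_one)
    (hCM : bsdTriple_of_hasCM_of_L_one_ne_zero) (hKob : Kobayashi2013.cor14_bsdp_of_cm_rank_one)
    (hYZ : YanZhu2026.thm415_padicValRat_bsd_rank_le_one)
    (hW20 : Wuthrich2014.lemma20_surjective_threeAdic_of_semistable)
    (hLLT : LiLiuTian2024.thm11_bsdp_of_cm_rank_one) : WAll ↔ WAllExclusions :=
  ⟨wAllExclusions_of_wAll, fun h ↦ wAll_of_exclusions h hSk hBCS hJSW hCGS hGV hGr hmod hmodP hGZK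
    hCM hKob hYZ hW20 hLLT⟩

/-- The sub-class `Prop`s and the sharp CM corner follow from `WAll` as well. [folklore] -/
theorem wAll_subclasses (h : WAll) :
    WAllExclX3 ∧ WAllExclX4 ∧ WAllExclX11b ∧ WAllExclX2RankOne ∧ WAllCornerFTwo ∧
      WAllCornerFRamified ∧ WAllCornerFInertBad ∧ WAllCornerFSharp := by
  obtain ⟨-, hAdd, hM1, -, -, -, -, -, -, -, -, hF⟩ := wAllExclusions_of_wAll h
  obtain ⟨h3, h4⟩ := wAllExclAdditive_iff.1 hAdd
  obtain ⟨h11b, h2c⟩ := wAllExclMultRankOne_iff.1 hM1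
  obtain ⟨hF2, hFr, hFi⟩ := wAllCornerF_iff.1 hF
  exact ⟨h3, h4, h11b, h2c, hF2, hFr, hFi, wAllCornerFSharp_of_cornerF hF⟩

/-! ### §6. The leading-term reading -/

/-- **`WAll` gives the FULL leading-term formula in analytic rank `≤ 1`**, granted modularity
(`hmod`), `L(E,1) ≥ 0` (`hL0`, Guo 1996 / Lapid–Rallis 2003) and Gross–Zagier in rank one (`hGZ`) —
used ONLY for the sign of `#Ш_an`, to which the valuations `ord_p` are blind (Miller 2011 §1, made
precise by the tree's `bsdTriple_of_forall_bsdp'` and `shaAn_re_pos_of_analyticRank_le_one'`; the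
rationality of `#Ш_an` is clause (iii) of `BSD(E,2)`). [cite: Miller2011LMS, §1 and Def. 1.1] -/
theorem wAllFormula_of_wAll (hmod : hasEntireLFunction_rat) (hL0 : re_entireLFunction_one_nonneg)
    (hGZ : gross_zagier_rank_one_rat) (h : WAll) : WAllFormula := by
  intro W _ _ hr
  have hall : ∀ p : ℕ, p.Prime → BSDp W p := fun p hp ↦ by
    haveI : Fact p.Prime := ⟨hp⟩
    exact h W p hr
  obtain ⟨-, -, q, hq, -⟩ := hall 2 Nat.prime_two
  exact bsdTriple_of_forall_bsdp' W (shaAn_re_pos_of_analyticRank_le_one' W hmod hL0 hGZ hr ⟨q, hq⟩)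
    hall

/-- **Conversely the leading-term form gives `WAll`** (Miller's easy direction,
`forall_bsdp_of_bsdTriple'`), unconditionally. [cite: Miller2011LMS, §1 and Def. 1.1] -/
theorem wAll_of_wAllFormula (h : WAllFormula) : WAll := by
  intro W _ _ p _ hr
  exact forall_bsdp_of_bsdTriple' W (h W hr) p Fact.out

/-- **Placement**: `WAllFormula` is the Literature conjecture `BSDConjecture` (RANK ∧ SHAFIN ∧ LEAD
for every globally minimal elliptic `W/ℚ`; Tate 1974 Conj. 4, Wiles' Clay text §1 Remarks 1)
restricted to analytic rank `≤ 1`. [cite: Tate1974] -/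
theorem wAllFormula_of_bsdConjecture (h : BSDConjecture) : WAllFormula :=
  fun W hE hmin _ ↦ (bsdConjecture_iff.1 h) W hE hmin

/-- **The leading-term form of rung W-ALL from the closed list**, the fourteen print binders of
CornersAll and the two sign binders. [folklore] -/
theorem wAllFormula_of_exclusions (h : WAllExclusions)
    (hSk : Skinner2016.thmC_padicValRat_bsd_rank_zero)
    (hBCS : BurungaleCastellaSkinner2025.cor131_padicValRat_bsd_rank_le_one)
    (hJSW : JetchevSkinnerWan2017.thm121_padicValRat_bsd_rank_one)
    (hCGS : CastellaGrossiSkinner2025.thmD_padicValRat_bsd_rank_le_one)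
    (hGV : GreenbergVatsal2000.thm13_charIdeal_eq_of_gvPar) (hGr : greenberg_charValue_rankZero)
    (hmod : hasEntireLFunction_rat) (hmodP : nonempty_modularParametrizationData)
    (hGZK : rank_eq_analyticRank_of_analyticRank_le_one)
    (hCM : bsdTriple_of_hasCM_of_L_one_ne_zero) (hKob : Kobayashi2013.cor14_bsdp_of_cm_rank_one)
    (hYZ : YanZhu2026.thm415_padicValRat_bsd_rank_le_one)
    (hW20 : Wuthrich2014.lemma20_surjective_threeAdic_of_semistable)
    (hLLT : LiLiuTian2024.thm11_bsdp_of_cm_rank_one)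
    (hL0 : re_entireLFunction_one_nonneg) (hGZ : gross_zagier_rank_one_rat) : WAllFormula :=
  wAllFormula_of_wAll hmod hL0 hGZ
    (wAll_of_exclusions h hSk hBCS hJSW hCGS hGV hGr hmod hmodP hGZK hCM hKob hYZ hW20 hLLT)

end Summit.BirchSwinnertonDyer

end
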